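import Literature.AlgebraicGeometry.Morphisms.CechModuleH2
import Literature.AlgebraicGeometry.Morphisms.CechModuleUnit
import Literature.AlgebraicGeometry.Modules.SheafHomFunctor
import Literature.AlgebraicGeometry.Motives.AbelianVarietyTangentSheafFree
import Literature.AlgebraicGeometry.GroupSchemes.CotangentSheafFreeOverLocalRing
import Mathlib.Algebra.Category.ModuleCat.Sheaf.Free
import Mathlib.CategoryTheory.Limits.Shapes.Biproducts
import HarnessLib

/-!
# `Ȟ²(𝒰, –)` is additive: functoriality API in degree `2`, `Ȟ²` of finite direct sums and of free
# modules of finite rank; `Ȟ²(𝒰, 𝒯_A) ≅ Ȟ²(𝒰, 𝒪_A)^g` for an abelian variety / abelian scheme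

Degree-`2` twin of `Morphisms/CechModuleBiproduct` (which treats `Ȟ¹`).  Sequel of
`Morphisms/CechModuleH2` (the Čech complex of a sheaf of `𝒪_X`-modules `M` on a family of opens `𝒰`
of an `A`-scheme `f : X → Spec A` in degrees `≤ 3`, `Ȟ²(𝒰, M) = Ž²/B̌²` as an `A`-module, and the
induced map `cechMapH2 : Ȟ²(𝒰, M) → Ȟ²(𝒰, N)` of a morphism `M ⟶ N`).  The Čech complex is an
ADDITIVE functor of the sheaf (The Stacks Project, Tag 01ED: "the Čech complex is functorial in the
sheaf"), hence so is `Ȟ²(𝒰, –)`; with the biproduct identity `∑ⱼ πⱼ ιⱼ = 𝟙` this gives: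

* §1 `cechMapH2_id_apply`, `cechMapH2_comp`, `cechMapH2_zero`, `cechMapH2_add_apply`,
  `cechMapH2_neg_apply`, `cechMapH2_sub_apply`, `cechMapH2_nsmul_apply`, `cechMapH2_zsmul_apply`,
  `cechMapH2_sum_apply` — `Ȟ²(𝒰, –)` is an additive functor; `cechMapH2_injective/surjective/
  bijective_of_iso`, `subsingleton_cechMH2_of_iso`, `exists_linearEquiv_cechMH2_of_iso` —
  **`Ȟ²(𝒰, M) ≃ₗ[A] Ȟ²(𝒰, N)` along `M ≅ N`**;
* §2 (finite biproducts `⨁ⱼ Fⱼ`) `sum_cechMapH2_ι_π`, `cechMapH2_π_ι_self/_ne`, `cechMapH2_π_sum_ι`,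
  `bijective_pi_cechMapH2_π`, **`exists_linearEquiv_cechMH2_biproduct` —
  `Ȟ²(𝒰, ⨁ⱼ Fⱼ) ≃ₗ[A] Πⱼ Ȟ²(𝒰, Fⱼ)`, `x ↦ (Ȟ²(πⱼ) x)ⱼ`, inverse `y ↦ ∑ⱼ Ȟ²(ιⱼ) yⱼ`**, natural in
  families of morphisms (`cechMapH2_π_map`, `cechMapH2_map_ι`); `subsingleton_cechMH2_biproduct_iff`;
* §3 (modules with a finite global frame `e : E ≅ 𝒪_X^I = SheafOfModules.free I`)
  **`exists_linearEquiv_cechMH2_of_iso_free` — `Ȟ²(𝒰, E) ≃ₗ[A] (I → Ȟ²(𝒰, 𝒪_X))`** with inverse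
  `y ↦ ∑ᵢ Ȟ²(ιFree i ≫ e⁻¹) yᵢ`; `subsingleton_cechMH2_of_iso_free`;
* §4 consumers: **`AbelianVariety.exists_frame_linearEquiv_cechMH2_tangentSheaf` —
  `Ȟ²(𝒰, 𝒯_A) ≃ₗ[k] (Fin (dim A) → Ȟ²(𝒰, 𝒪_A))`** for an abelian variety over a field (the tangent
  sheaf is free on the invariant vector fields, [MumfordAV1970] §4 (iii), tree
  `Motives/AbelianVarietyTangentSheafFree`), and `AbelianSchemeOver.exists_frame_linearEquiv_cechMH2_
  tangentSheaf_of_isLocalRing` for an abelian scheme of relative dimension `g` over a local ring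
  (tree `GroupSchemes/CotangentSheafFreeOverLocalRing`) — the `Ȟ²(𝒰, 𝒯) ≅ Lie ⊗ Ȟ²(𝒰, 𝒪)` dictionary
  in which obstruction classes `[o] ∈ Ȟ²(X_s, 𝒯_{X_s})` of deformations of an abelian variety are
  read componentwise ([Oort1971] §2; [MumfordFogartyKirwan1994] App. 7A).

THEOREMS ONLY: linear equivalences are delivered as `∃ Φ : _ ≃ₗ[A] _, ‹defining formulas›`; no
definition, no named fact, no instance, no `sorry`.  The `𝒪_X`-carrier is `unitModule X`
(`Modules/SheafHomFunctor`; reducibly Mathlib's `SheafOfModules.unit X.ringCatSheaf`, the carrier of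
`Morphisms/CechModuleUnit.CechMH1_unit` — there is no separate structure-sheaf `Ȟ²` type in the tree).
Design note: `Ȟ²(𝒰, SheafOfModules.free I)` itself is never used as a carrier (its section types unfold
badly under unification); frames enter only through `e : E ≅ SheafOfModules.free I`, as the tree's frame
theorems deliver them.  Mathlib searched (pin v4.32): `biproduct.ι_π_self/_ne`, `IsBilimit.total`,
`biproduct.map_π`, `biproduct.ι_map`, `biproduct.isColimit`, `IsColimit.coconePointUniqueUpToIso`,
`SheafOfModules.free/ιFree/isColimitFreeCofan` (used); no Čech cohomology of sheaves of modules on schemes.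
Cell hodgecm-mathlib (D-0151), F-11 α1 / J4-(iv) brick (iv-2) of `F0/P1b/p04/CENSUS-J4iv-Unobstructed`
(the `[n]^*`-compatibility of the splitting is NOT in this file).  HC_CM is proved only modulo the 7
printed citations until rung 0 closes; nothing here bears on it.

## References

* The Stacks Project, Tag 01ED (Cohomology, Section 20.9: the Čech complex and its functoriality).
  [StacksProject]
* R. Hartshorne, *Algebraic Geometry*, GTM 52 (1977): III §4 (Čech cohomology), II Ex. 5.1 (b).
  [Hartshorne1977]
* D. Mumford, *Abelian Varieties* (1970), §4 (iii) p. 42 (invariant vector fields; `Ω¹`, `𝒯` free).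
  [MumfordAV1970]
* D. Mumford, J. Fogarty, F. Kirwan, *Geometric Invariant Theory*, 3rd ed. (1994), App. 7A p. 235.
  [MumfordFogartyKirwan1994]
-/

noncomputable section

open CategoryTheory AlgebraicGeometry Limits TopologicalSpace Opposite

universe u v w

namespace Literature.AlgebraicGeometry.Morphisms

variable {A : Type u} [CommRing A] {X : Scheme.{u}} (f : X ⟶ Spec (.of A)) {ι : Type v}
  (U : ι → X.Opens)

/-! ## §1 `Ȟ²(𝒰, –)` is an additive functor of the sheaf of modules -/

section Functor

variable {M N P : X.Modules}

/-- `Ȟ²(𝒰, 𝟙_M) = id`. [cite: StacksProject, Tag 01ED (Cohomology, Section 20.9)] -/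
@[simp]
theorem cechMapH2_id_apply (x : CechMH2 f M U) : cechMapH2 f (𝟙 M) U x = x := by
  obtain ⟨z, rfl⟩ := CechMH2.mk_surjective f M U x
  rw [cechMapH2_mk]
  congr 1

/-- `Ȟ²` of a composite: `Ȟ²(φ ≫ ψ) = Ȟ²(ψ) ∘ Ȟ²(φ)`.
[cite: StacksProject, Tag 01ED (Cohomology, Section 20.9)] -/
theorem cechMapH2_comp (φ : M ⟶ N) (ψ : N ⟶ P) (x : CechMH2 f M U) :
    cechMapH2 f (φ ≫ ψ) U x = cechMapH2 f ψ U (cechMapH2 f φ U x) := by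
  obtain ⟨z, rfl⟩ := CechMH2.mk_surjective f M U x
  rfl

/-- `Ȟ²` of the zero morphism is zero. [cite: StacksProject, Tag 01ED (Cohomology, Section 20.9)] -/
@[simp]
theorem cechMapH2_zero (x : CechMH2 f M U) : cechMapH2 f (0 : M ⟶ N) U x = 0 := by
  obtain ⟨z, rfl⟩ := CechMH2.mk_surjective f M U x
  rw [cechMapH2_mk, ← map_zero (CechMH2.mk f N U)]
  congr 1

/-- **`Ȟ²(𝒰, –)` is additive**: `Ȟ²(φ + ψ) = Ȟ²(φ) + Ȟ²(ψ)` (the Čech complex is an additive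
functor of the sheaf). [cite: StacksProject, Tag 01ED (Cohomology, Section 20.9)] -/
theorem cechMapH2_add_apply (φ ψ : M ⟶ N) (x : CechMH2 f M U) :
    cechMapH2 f (φ + ψ) U x = cechMapH2 f φ U x + cechMapH2 f ψ U x := by
  obtain ⟨z, rfl⟩ := CechMH2.mk_surjective f M U x
  rw [cechMapH2_mk, cechMapH2_mk, cechMapH2_mk, ← map_add]
  congr 1

/-- `φ ↦ Ȟ²(𝒰, φ) x` as an additive homomorphism `(M ⟶ N) →+ Ȟ²(𝒰, N)` (bookkeeping form of
additivity). [cite: StacksProject, Tag 01ED (Cohomology, Section 20.9)] -/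
private theorem exists_addMonoidHom_cechMapH2 (x : CechMH2 f M U) :
    ∃ h : (M ⟶ N) →+ CechMH2 f N U, ∀ φ, h φ = cechMapH2 f φ U x :=
  ⟨{ toFun := fun φ => cechMapH2 f φ U x
     map_zero' := cechMapH2_zero f U x
     map_add' := fun φ ψ => cechMapH2_add_apply f U φ ψ x }, fun _ => rfl⟩

/-- `Ȟ²(-φ) = -Ȟ²(φ)`. [cite: StacksProject, Tag 01ED (Cohomology, Section 20.9)] -/
theorem cechMapH2_neg_apply (φ : M ⟶ N) (x : CechMH2 f M U) :
    cechMapH2 f (-φ) U x = -cechMapH2 f φ U x := by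
  obtain ⟨h, hh⟩ := exists_addMonoidHom_cechMapH2 f U (N := N) x
  rw [← hh, ← hh, map_neg]

/-- `Ȟ²(φ - ψ) = Ȟ²(φ) - Ȟ²(ψ)`. [cite: StacksProject, Tag 01ED (Cohomology, Section 20.9)] -/
theorem cechMapH2_sub_apply (φ ψ : M ⟶ N) (x : CechMH2 f M U) :
    cechMapH2 f (φ - ψ) U x = cechMapH2 f φ U x - cechMapH2 f ψ U x := by
  obtain ⟨h, hh⟩ := exists_addMonoidHom_cechMapH2 f U (N := N) x
  rw [← hh, ← hh, ← hh, map_sub]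

/-- `Ȟ²(n • φ) = n • Ȟ²(φ)` for `n : ℕ`. [cite: StacksProject, Tag 01ED (Cohomology, Section 20.9)] -/
theorem cechMapH2_nsmul_apply (n : ℕ) (φ : M ⟶ N) (x : CechMH2 f M U) :
    cechMapH2 f (n • φ) U x = n • cechMapH2 f φ U x := by
  obtain ⟨h, hh⟩ := exists_addMonoidHom_cechMapH2 f U (N := N) x
  rw [← hh, ← hh, map_nsmul]

/-- `Ȟ²(n • φ) = n • Ȟ²(φ)` for `n : ℤ`. [cite: StacksProject, Tag 01ED (Cohomology, Section 20.9)] -/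
theorem cechMapH2_zsmul_apply (n : ℤ) (φ : M ⟶ N) (x : CechMH2 f M U) :
    cechMapH2 f (n • φ) U x = n • cechMapH2 f φ U x := by
  obtain ⟨h, hh⟩ := exists_addMonoidHom_cechMapH2 f U (N := N) x
  rw [← hh, ← hh, map_zsmul]

/-- **`Ȟ²(𝒰, –)` is additive on finite sums of morphisms**:
`Ȟ²(∑_{j ∈ s} φⱼ) x = ∑_{j ∈ s} Ȟ²(φⱼ) x`. [cite: StacksProject, Tag 01ED (Cohomology, Section 20.9)] -/
theorem cechMapH2_sum_apply {J : Type w} (s : Finset J) (φ : J → (M ⟶ N)) (x : CechMH2 f M U) :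
    cechMapH2 f (∑ j ∈ s, φ j) U x = ∑ j ∈ s, cechMapH2 f (φ j) U x := by
  obtain ⟨h, hh⟩ := exists_addMonoidHom_cechMapH2 f U (N := N) x
  rw [← hh, map_sum]
  exact Finset.sum_congr rfl fun j _ => hh (φ j)

/-- `Ȟ²(𝒰, e)` is injective for an isomorphism `e`. [cite: StacksProject, Tag 01ED (Cohomology, Section 20.9)] -/
theorem cechMapH2_injective_of_iso (e : M ≅ N) : Function.Injective (cechMapH2 f e.hom U) := by
  intro x y hxy
  have h := congrArg (cechMapH2 f e.inv U) hxy
  rwa [← cechMapH2_comp, ← cechMapH2_comp, e.hom_inv_id, cechMapH2_id_apply,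
    cechMapH2_id_apply] at h

/-- `Ȟ²(𝒰, e)` is surjective for an isomorphism `e`. [cite: StacksProject, Tag 01ED (Cohomology, Section 20.9)] -/
theorem cechMapH2_surjective_of_iso (e : M ≅ N) : Function.Surjective (cechMapH2 f e.hom U) :=
  fun y => ⟨cechMapH2 f e.inv U y, by rw [← cechMapH2_comp, e.inv_hom_id, cechMapH2_id_apply]⟩

/-- `Ȟ²(𝒰, e)` is bijective for an isomorphism `e`. [cite: StacksProject, Tag 01ED (Cohomology, Section 20.9)] -/
theorem cechMapH2_bijective_of_iso (e : M ≅ N) : Function.Bijective (cechMapH2 f e.hom U) :=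
  ⟨cechMapH2_injective_of_iso f U e, cechMapH2_surjective_of_iso f U e⟩

/-- `Ȟ²` vanishing is invariant under isomorphism: if `M ≅ N` and `Ȟ²(𝒰, N) = 0` then
`Ȟ²(𝒰, M) = 0`. [cite: StacksProject, Tag 01ED (Cohomology, Section 20.9)] -/
theorem subsingleton_cechMH2_of_iso (e : M ≅ N) (h : Subsingleton (CechMH2 f N U)) :
    Subsingleton (CechMH2 f M U) :=
  (cechMapH2_injective_of_iso f U e).subsingleton

/-- **`Ȟ²(𝒰, M) ≃ₗ[A] Ȟ²(𝒰, N)` along an isomorphism `e : M ≅ N`**: there is an `A`-linear equivalence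
whose forward map is `Ȟ²(𝒰, e)` and whose inverse is `Ȟ²(𝒰, e⁻¹)`.
[cite: StacksProject, Tag 01ED (Cohomology, Section 20.9)] -/
theorem exists_linearEquiv_cechMH2_of_iso (e : M ≅ N) :
    ∃ Φ : CechMH2 f M U ≃ₗ[A] CechMH2 f N U,
      (∀ x, Φ x = cechMapH2 f e.hom U x) ∧ ∀ y, Φ.symm y = cechMapH2 f e.inv U y :=
  ⟨{ cechMapH2 f e.hom U with
      invFun := cechMapH2 f e.inv U
      left_inv := fun x => by
        simp only [LinearMap.toFun_eq_coe]
        rw [← cechMapH2_comp, e.hom_inv_id, cechMapH2_id_apply]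
      right_inv := fun y => by
        simp only [LinearMap.toFun_eq_coe]
        rw [← cechMapH2_comp, e.inv_hom_id, cechMapH2_id_apply] },
    fun _ => rfl, fun _ => rfl⟩

end Functor

/-! ## §2 `Ȟ²` of finite direct sums -/

section Biproduct

variable {J : Type w} (F : J → X.Modules) [HasBiproduct F]

/-- `Ȟ²(πⱼ) (Ȟ²(ιⱼ) y) = y`. [cite: StacksProject, Tag 01ED (Cohomology, Section 20.9)] -/
@[simp]
theorem cechMapH2_π_ι_self (j : J) (y : CechMH2 f (F j) U) :
    cechMapH2 f (biproduct.π F j) U (cechMapH2 f (biproduct.ι F j) U y) = y := by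
  rw [← cechMapH2_comp, biproduct.ι_π_self, cechMapH2_id_apply]

/-- `Ȟ²(πⱼ) (Ȟ²(ιᵢ) y) = 0` for `i ≠ j`. [cite: StacksProject, Tag 01ED (Cohomology, Section 20.9)] -/
theorem cechMapH2_π_ι_ne {i j : J} (h : i ≠ j) (y : CechMH2 f (F i) U) :
    cechMapH2 f (biproduct.π F j) U (cechMapH2 f (biproduct.ι F i) U y) = 0 := by
  rw [← cechMapH2_comp, biproduct.ι_π_ne F h, cechMapH2_zero]

/-- **The biproduct identity on `Ȟ²`**: `∑ⱼ Ȟ²(ιⱼ) (Ȟ²(πⱼ) x) = x` for `x ∈ Ȟ²(𝒰, ⨁ⱼ Fⱼ)`, `J`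
finite (`∑ⱼ πⱼ ιⱼ = 𝟙`, Mathlib `IsBilimit.total`, and additivity of `Ȟ²`).
[cite: StacksProject, Tag 01ED (Cohomology, Section 20.9)] -/
theorem sum_cechMapH2_ι_π [Fintype J] (x : CechMH2 f (⨁ F) U) :
    ∑ j, cechMapH2 f (biproduct.ι F j) U (cechMapH2 f (biproduct.π F j) U x) = x := by
  -- `∑ⱼ πⱼ ιⱼ = 𝟙` (Mathlib `biproduct.total`, in the universe-polymorphic form `IsBilimit.total`)
  have htot : ∑ j, biproduct.π F j ≫ biproduct.ι F j = 𝟙 (⨁ F) :=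
    Limits.IsBilimit.total (biproduct.isBilimit F)
  conv_rhs => rw [← cechMapH2_id_apply f U x, ← htot, cechMapH2_sum_apply]
  exact Finset.sum_congr rfl fun j _ => (cechMapH2_comp f U _ _ x).symm

/-- `Ȟ²(πⱼ) (∑ᵢ Ȟ²(ιᵢ) yᵢ) = yⱼ`. [cite: StacksProject, Tag 01ED (Cohomology, Section 20.9)] -/
theorem cechMapH2_π_sum_ι [Fintype J] (y : ∀ j, CechMH2 f (F j) U) (j : J) :
    cechMapH2 f (biproduct.π F j) U (∑ i, cechMapH2 f (biproduct.ι F i) U (y i)) = y j := by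
  classical
  rw [map_sum, Finset.sum_eq_single j (fun i _ hij => cechMapH2_π_ι_ne f U F hij (y i))
    (fun h => absurd (Finset.mem_univ j) h), cechMapH2_π_ι_self]

/-- **`x ↦ (Ȟ²(πⱼ) x)ⱼ : Ȟ²(𝒰, ⨁ⱼ Fⱼ) → Πⱼ Ȟ²(𝒰, Fⱼ)` is bijective** (`J` finite).
[cite: StacksProject, Tag 01ED (Cohomology, Section 20.9)] -/
theorem bijective_pi_cechMapH2_π [Finite J] :
    Function.Bijective (LinearMap.pi fun j => cechMapH2 f (biproduct.π F j) U :
      CechMH2 f (⨁ F) U →ₗ[A] ∀ j, CechMH2 f (F j) U) := by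
  cases nonempty_fintype J
  refine ⟨fun x x' h => ?_, fun y => ⟨∑ i, cechMapH2 f (biproduct.ι F i) U (y i), ?_⟩⟩
  · rw [← sum_cechMapH2_ι_π f U F x, ← sum_cechMapH2_ι_π f U F x']
    exact Finset.sum_congr rfl fun j _ => by rw [show cechMapH2 f (biproduct.π F j) U x =
      cechMapH2 f (biproduct.π F j) U x' from congrFun h j]
  · exact funext fun j => cechMapH2_π_sum_ι f U F y j

/-- **`Ȟ²(𝒰, ⨁ⱼ Fⱼ) ≃ₗ[A] Πⱼ Ȟ²(𝒰, Fⱼ)`** (`J` finite): the `A`-linear equivalence `x ↦ (Ȟ²(πⱼ) x)ⱼ`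
with inverse `y ↦ ∑ⱼ Ȟ²(ιⱼ) yⱼ` — `Ȟ²(𝒰, –)`, being additive, preserves finite biproducts.
[cite: StacksProject, Tag 01ED (Cohomology, Section 20.9)] -/
theorem exists_linearEquiv_cechMH2_biproduct [Fintype J] :
    ∃ Φ : CechMH2 f (⨁ F) U ≃ₗ[A] (∀ j, CechMH2 f (F j) U),
      (∀ x j, Φ x j = cechMapH2 f (biproduct.π F j) U x) ∧
        ∀ y, Φ.symm y = ∑ j, cechMapH2 f (biproduct.ι F j) U (y j) :=
  ⟨{ (LinearMap.pi fun j => cechMapH2 f (biproduct.π F j) U :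
        CechMH2 f (⨁ F) U →ₗ[A] ∀ j, CechMH2 f (F j) U) with
      invFun := fun y => ∑ j, cechMapH2 f (biproduct.ι F j) U (y j)
      left_inv := fun x => sum_cechMapH2_ι_π f U F x
      right_inv := fun y => funext fun j => cechMapH2_π_sum_ι f U F y j },
    fun _ _ => rfl, fun _ => rfl⟩

/-- Naturality of the components in a family of morphisms `φⱼ : Fⱼ ⟶ Gⱼ`:
`Ȟ²(π^G_j) (Ȟ²(⨁ φ) x) = Ȟ²(φⱼ) (Ȟ²(π^F_j) x)`. [cite: StacksProject, Tag 01ED (Cohomology, Section 20.9)] -/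
theorem cechMapH2_π_map {G : J → X.Modules} [HasBiproduct G] (φ : ∀ j, F j ⟶ G j)
    (x : CechMH2 f (⨁ F) U) (j : J) :
    cechMapH2 f (biproduct.π G j) U (cechMapH2 f (biproduct.map φ) U x) =
      cechMapH2 f (φ j) U (cechMapH2 f (biproduct.π F j) U x) := by
  rw [← cechMapH2_comp, ← cechMapH2_comp, biproduct.map_π]

/-- Naturality of the inclusions in a family of morphisms `φⱼ : Fⱼ ⟶ Gⱼ`:
`Ȟ²(⨁ φ) (Ȟ²(ι^F_j) y) = Ȟ²(ι^G_j) (Ȟ²(φⱼ) y)`. [cite: StacksProject, Tag 01ED (Cohomology, Section 20.9)] -/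
theorem cechMapH2_map_ι {G : J → X.Modules} [HasBiproduct G] (φ : ∀ j, F j ⟶ G j) (j : J)
    (y : CechMH2 f (F j) U) :
    cechMapH2 f (biproduct.map φ) U (cechMapH2 f (biproduct.ι F j) U y) =
      cechMapH2 f (biproduct.ι G j) U (cechMapH2 f (φ j) U y) := by
  rw [← cechMapH2_comp, ← cechMapH2_comp, biproduct.ι_map]

/-- **`Ȟ²(𝒰, ⨁ⱼ Fⱼ) = 0` iff all `Ȟ²(𝒰, Fⱼ) = 0`** (`J` finite).
[cite: StacksProject, Tag 01ED (Cohomology, Section 20.9)] -/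
theorem subsingleton_cechMH2_biproduct_iff [Finite J] :
    Subsingleton (CechMH2 f (⨁ F) U) ↔ ∀ j, Subsingleton (CechMH2 f (F j) U) := by
  refine ⟨fun h j => ⟨fun y y' => ?_⟩, fun h => ?_⟩
  · rw [← cechMapH2_π_ι_self f U F j y, ← cechMapH2_π_ι_self f U F j y',
      Subsingleton.elim (cechMapH2 f (biproduct.ι F j) U y)]
  · haveI : ∀ j, Subsingleton (CechMH2 f (F j) U) := h
    exact (bijective_pi_cechMapH2_π f U F).1.subsingleton

end Biproduct

/-! ## §3 Modules with a finite global frame `E ≅ 𝒪_X^I` -/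

section Free

open Literature.AlgebraicGeometry.Modules (unitModule)

variable (I : Type u)

/-- `⨁_I 𝒪_X` exists in `Mod(𝒪_X)` for `I` finite (finite biproducts from finite products). [folklore] -/
private theorem hasBiproduct_unitModule [Finite I] : HasBiproduct fun _ : I => unitModule X := by
  haveI : HasFiniteBiproducts X.Modules := HasFiniteBiproducts.of_hasFiniteProducts
  infer_instance

/-- The comparison `⨁_I 𝒪_X ≅ 𝒪_X^I = SheafOfModules.free I` (both are coproducts of `I` copies of `𝒪_X`:
Mathlib `biproduct.isColimit`, `SheafOfModules.isColimitFreeCofan`) matches the inclusions: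
`ιᵢ ≫ (⨁ ≅ free) = ιFree i`. [folklore] -/
private theorem ι_comp_isoFree_hom [HasBiproduct fun _ : I => unitModule X] (i : I) :
    biproduct.ι (fun _ : I => unitModule X) i ≫
        (IsColimit.coconePointUniqueUpToIso (biproduct.isColimit fun _ : I => unitModule X)
          (SheafOfModules.isColimitFreeCofan (R := X.ringCatSheaf) I)).hom =
      SheafOfModules.ιFree (R := X.ringCatSheaf) i := by
  simpa [SheafOfModules.freeCofan] using IsColimit.comp_coconePointUniqueUpToIso_hom
    (biproduct.isColimit fun _ : I => unitModule X)
    (SheafOfModules.isColimitFreeCofan (R := X.ringCatSheaf) I) ⟨i⟩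

/-- **`Ȟ²` through a finite global frame: `Ȟ²(𝒰, E) ≃ₗ[A] (I → Ȟ²(𝒰, 𝒪_X))`** for an `𝒪_X`-module `E`
with `e : E ≅ 𝒪_X^I = SheafOfModules.free I`, `I` finite — the `A`-linear equivalence whose INVERSE is
`y ↦ ∑ᵢ Ȟ²(ιFree i ≫ e⁻¹) yᵢ` (which determines it): `E ≅ free I ≅ ⨁_I 𝒪_X` (Mathlib
`SheafOfModules.isColimitFreeCofan` against `biproduct.isColimit`) and `exists_linearEquiv_cechMH2_biproduct`.
[cite: StacksProject, Tag 01ED (Cohomology, Section 20.9)] -/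
theorem exists_linearEquiv_cechMH2_of_iso_free [Fintype I] {E : X.Modules}
    (e : E ≅ SheafOfModules.free (R := X.ringCatSheaf) I) :
    ∃ Φ : CechMH2 f E U ≃ₗ[A] (I → CechMH2 f (unitModule X) U),
      ∀ y, Φ.symm y =
        ∑ i, cechMapH2 f (SheafOfModules.ιFree (R := X.ringCatSheaf) i ≫ e.inv) U (y i) := by
  haveI := hasBiproduct_unitModule (X := X) I
  -- `E ≅ free I ≅ ⨁_I 𝒪_X` (two colimit cocones of the same discrete diagram)
  obtain ⟨Φ₁, -, hΦ₁⟩ := exists_linearEquiv_cechMH2_of_iso f U (M := E)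
    (N := ⨁ fun _ : I => unitModule X)
    (e ≪≫ (IsColimit.coconePointUniqueUpToIso (biproduct.isColimit fun _ : I => unitModule X)
      (SheafOfModules.isColimitFreeCofan (R := X.ringCatSheaf) I)).symm)
  obtain ⟨Φ₂, -, hΦ₂⟩ := exists_linearEquiv_cechMH2_biproduct f U (fun _ : I => unitModule X)
  refine ⟨Φ₁.trans Φ₂, fun y => ?_⟩
  show Φ₁.symm (Φ₂.symm y) = _
  rw [hΦ₂, hΦ₁, map_sum]
  refine Finset.sum_congr rfl fun i _ => ?_
  rw [← cechMapH2_comp, Iso.trans_inv, Iso.symm_inv, ← Category.assoc]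
  exact congrArg (fun φ => cechMapH2 f (φ ≫ e.inv) U (y i)) (ι_comp_isoFree_hom (X := X) I i)

/-- **`Ȟ²(𝒰, E) = 0` for a module with a finite global frame `E ≅ 𝒪_X^I` if `Ȟ²(𝒰, 𝒪_X) = 0`.**
[cite: StacksProject, Tag 01ED (Cohomology, Section 20.9)] -/
theorem subsingleton_cechMH2_of_iso_free [Finite I] {E : X.Modules}
    (e : E ≅ SheafOfModules.free (R := X.ringCatSheaf) I)
    (hO : Subsingleton (CechMH2 f (unitModule X) U)) : Subsingleton (CechMH2 f E U) := by
  cases nonempty_fintype I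
  obtain ⟨Φ, -⟩ := exists_linearEquiv_cechMH2_of_iso_free f U I e
  exact Φ.toEquiv.subsingleton

end Free

end Literature.AlgebraicGeometry.Morphisms

/-! ## §4 Consumers: the tangent sheaf of an abelian variety / abelian scheme over a local ring -/

namespace Literature.AlgebraicGeometry.Motives.AbelianVariety

open Literature.AlgebraicGeometry.Morphisms Literature.AlgebraicGeometry.HodgeTheory
open Literature.AlgebraicGeometry.Modules (unitModule)

variable {k : Type} [Field k] (A : AbelianVariety k) {ι : Type v} (U : ι → A.X.left.Opens)

/-- **`Ȟ²(𝒰, 𝒯_A) ≃ₗ[k] (Fin (dim A) → Ȟ²(𝒰, 𝒪_A))` for an abelian variety over a field**: a global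
frame `e : 𝒯_A ≅ 𝒪_A^{dim A}` of the tangent sheaf on the invariant vector fields (`𝒯_A ≅ 𝒪_A ⊗_k Lie A`,
tree `nonempty_tangentSheaf_iso_free`) together with the induced componentwise reading of
`Ȟ²(𝒰, 𝒯_A)`-classes, inverse `y ↦ Ȟ²(e⁻¹) (∑ᵢ Ȟ²(ιFree i) yᵢ)` — the `Ȟ²(𝒯) ≅ Lie ⊗ Ȟ²(𝒪)`
dictionary for obstruction classes of deformations of `A`.
[cite: MumfordAV1970, §4 (iii) (p. 42)] [cite: StacksProject, Tag 01ED (Cohomology, Section 20.9)] -/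
theorem exists_frame_linearEquiv_cechMH2_tangentSheaf :
    ∃ (e : tangentSheaf A.X ≅ SheafOfModules.free (R := A.X.left.ringCatSheaf) (Fin A.dim))
      (Φ : CechMH2 A.X.hom (tangentSheaf A.X) U ≃ₗ[k]
        (Fin A.dim → CechMH2 A.X.hom (unitModule A.X.left) U)),
      ∀ y, Φ.symm y =
        ∑ i, cechMapH2 A.X.hom (SheafOfModules.ιFree (R := A.X.left.ringCatSheaf) i ≫ e.inv) U (y i) := by
  obtain ⟨e⟩ := nonempty_tangentSheaf_iso_free A
  obtain ⟨Φ, hΦ⟩ := exists_linearEquiv_cechMH2_of_iso_free A.X.hom U (Fin A.dim) e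
  exact ⟨e, Φ, hΦ⟩

end Literature.AlgebraicGeometry.Motives.AbelianVariety

namespace Literature.AlgebraicGeometry.AbelianSchemes.AbelianSchemeOver

open Literature.AlgebraicGeometry.Morphisms Literature.AlgebraicGeometry.HodgeTheory
open Literature.AlgebraicGeometry.Modules (unitModule)

variable {R : Type} [CommRing R] [IsLocalRing R] (A : AbelianSchemeOver (Spec (CommRingCat.of R)))
  {g : ℕ} {ι : Type v} (U : ι → A.X.left.Opens)

/-- **`Ȟ²(𝒰, 𝒯_{A/R}) ≃ₗ[R] (Fin g → Ȟ²(𝒰, 𝒪_A))` for an abelian scheme of relative dimension `g` over a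
LOCAL ring** (e.g. an Artin local base): a global frame `e : 𝒯_{A/R} ≅ 𝒪_A^g` (tree
`nonempty_tangentSheaf_iso_free_of_isLocalRing`) and the induced componentwise reading of
`Ȟ²(𝒰, 𝒯)`-classes — the `Ȟ²(𝒯) ≅ Lie ⊗ Ȟ²(𝒪)` dictionary of the F-11 rows A4a∕A4b.
[cite: MumfordAV1970, §4 (iii) (p. 42)] [cite: StacksProject, Tag 01ED (Cohomology, Section 20.9)] -/
theorem exists_frame_linearEquiv_cechMH2_tangentSheaf_of_isLocalRing (hA : A.IsOfRelDim g) :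
    ∃ (e : tangentSheaf A.X ≅ SheafOfModules.free (R := A.X.left.ringCatSheaf) (Fin g))
      (Φ : CechMH2 A.X.hom (tangentSheaf A.X) U ≃ₗ[R]
        (Fin g → CechMH2 A.X.hom (unitModule A.X.left) U)),
      ∀ y, Φ.symm y =
        ∑ i, cechMapH2 A.X.hom (SheafOfModules.ιFree (R := A.X.left.ringCatSheaf) i ≫ e.inv) U (y i) := by
  obtain ⟨e⟩ := nonempty_tangentSheaf_iso_free_of_isLocalRing A hA
  obtain ⟨Φ, hΦ⟩ := exists_linearEquiv_cechMH2_of_iso_free A.X.hom U (Fin g) e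
  exact ⟨e, Φ, hΦ⟩

end Literature.AlgebraicGeometry.AbelianSchemes.AbelianSchemeOver

end
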